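import Summits.BirchSwinnertonDyer.BirchSwinnertonDyer.Theorems.ByReductionTypeAtTwoMultTransportTwistedDescentPT
import Summits.BirchSwinnertonDyer.BirchSwinnertonDyer.Theorems.ByReductionTypeAtTwoMultTransportTwistedDescentGenericLevel
import HarnessLib

/-!
# T-42 in the kernel, generic twisted descent (LXV-f): the ∀-wrappers of file `…TwistedDescentPT` with a
# PREDICATE `R` in place of the threaded binder `W.HasMultiplicativeReductionAtPrime 2`

Cell `bsd-2adic` (run/shared/lean/pub/bsd-2adic/), seat `bsd-2adic-t42` (BRIEF-T42), GEN 29 (memo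
`t42/DESIGN-T42-ADDENDUM-33.md`, «F3a road»: Matsuno's Lemma 4.5 (i) at a GOOD ORDINARY `2` as a kernel theorem).
HONEST FRAMING: research route; THEOREMS ONLY (no `def`, no named fact, no instance); nothing booked; nothing re-keyed;
BSD is not proved by any of this. PARTITION: X5@2 GV-transport rows whose REFERENCE curve is GOOD ORDINARY at `2`
(K4ᵐ B1·O1 `MultCongruenceTransportAtTwo`; the binder `hF3a` of p744459) × p = 2 — types-the-object-of; bears_on K4 items
19922 / 19923 (`--supports stmt-BirchSwinnertonDyer-19923`).

## What

In files XIV–XXX of the multiplicative road (`hF3b`), the reduction hypothesis `W.HasMultiplicativeReductionAtPrime 2`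
of the ∀-statements `LIFT`, `LIFT₁`, `LIFT₂`, `LIFT₃`, `T2`, `δ2`, `δinf` and of the conclusion is only THREADED — it is
consumed by the two local inputs at the end of the chain (the Tate-line package at `2`), never by the wrappers. This file
re-lands the wrappers of `…TwistedDescentPT` with an arbitrary predicate
`R : ∀ (W : WeierstrassCurve ℚ) [W.IsElliptic] [W.IsGloballyMinimal], Prop` in place of that binder (names suffixed
`_R`, `R` the first explicit argument; statements and proofs otherwise VERBATIM). Instantiated at
`R W := IsOrdinaryAt W 2` with the good-ordinary local inputs (`…TwistedDescentOrdLinePackage`, `…OrdT2Final`) the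
chain yields `Matsuno2008.lemma45i_noFiniteSubmodule_nonPrimitive_goodOrd_two` from Greenberg's Prop. 4.9; at
`R W := W.HasMultiplicativeReductionAtPrime 2` it is the original chain.

Declarations: `levelLift_of_orthogonal_R`, `hF3b_of_prop49_PT_R`.

References: [GreenbergLNM1716] §4 Lemma 4.6, Prop. 4.9, Props. 4.13–4.15 (pp. 105–126); [GreenbergVatsal2000] §2 pp. 14–17;
[MilneADT2006] I Thm. 4.10, Cor. 2.3.
-/


set_option autoImplicit false
set_option linter.dupNamespace false

noncomputable section

open scoped Classical

universe u

namespace Summit.BirchSwinnertonDyer.BirchSwinnertonDyer.Theorems.MultTransportTwistedDescent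

open NumberField IsDedekindDomain Field WeierstrassCurve
  Literature.NumberTheory.EllipticCurves Literature.NumberTheory.EllipticCurves.GreenbergVatsal2000
  Literature.NumberTheory.EllipticCurves.Greenberg1999
  Literature.NumberTheory.GaloisRepresentations Literature.NumberTheory.GaloisCohomology
  Summit.BirchSwinnertonDyer.BirchSwinnertonDyer.Theorems.MultTransportAtTwo
open Literature.NumberTheory.GaloisRepresentations.DiscreteGaloisModule (localTatePairingZMod)

/-- **`levelLift_of_orthogonal_R : poitouTate_selmerStructure_duality_real ℚ → LIFT₃ → LIFT₂`.** If, for all but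
finitely many odd `u`, every `c ∈ H` with `ψ_u c` Kummer at the place above `2` and at the real place admits a
level `J` and a target family `t` over `ℚ` (supported at `2` and `∞`, mapping to `loc_v c` there) whose local
terms against EVERY `y ∈ H¹_{𝓕^*}(ℚ, E[2^J](χ_u)^D)` vanish at `2` and `∞` for every family of local invariant
maps with the five printed properties, then `LIFT₂` holds: Poitou–Tate (`SelmerComplement` of the family given
by `poitouTate_selmerStructure_duality_real ℚ` at `n = 2^J`) produces `x ∈ H¹_𝓖(ℚ, E[2^J](χ_u))` with
`loc_v x − t_v ∈ 𝓕_v` on `S` (`WeierstrassCurve.exists_twistedLift_of_orthogonal_two`), i.e. `x` unramified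
outside `S₀ ∪ {2}` with `twistedTorsionToLocalH1 (loc_v x) = twistedTorsionToLocalH1 (t_v) = localResOver_v c` at
`2` and `∞`. The bad set of `LIFT₂` is contained in the bad set of `LIFT₃`, `u` by `u`.
[cite: GreenbergLNM1716, §4 pp. 122–124] [cite: Howard2004HeegnerKolyvagin, Thm. 2.1.11 (arXiv:1202.6340 p. 6)] -/
theorem levelLift_of_orthogonal_R (R : ∀ (W : WeierstrassCurve ℚ) [W.IsElliptic] [W.IsGloballyMinimal], Prop) (hPT : poitouTate_selmerStructure_duality_real ℚ)
    (LIFT₃ : ∀ (W : WeierstrassCurve ℚ) [W.IsElliptic] [W.IsGloballyMinimal],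
      R W →
      ∀ (κ : ZpExtension ℚ 2) (_hκ : κ.IsCyclotomic) (γ : absoluteGaloisGroup ℚ)
        (_hγ : κ.IsTopGenerator γ) (S₀ : Finset (HeightOneSpectrum (𝓞 ℚ)))
        (_hne : S₀.Nonempty)
        (_hS₀ : ∀ v ∈ S₀, ((2 : ℕ) : 𝓞 ℚ) ∉ v.asIdeal)
        (_hbad : ∀ v : HeightOneSpectrum (𝓞 ℚ), v ∉ S₀ → ((2 : ℕ) : 𝓞 ℚ) ∉ v.asIdeal →
          W.HasGoodReductionAt v)
        (D : W.SelmerDualData κ γ) [Module.Finite (IwasawaAlgebra 2) D.X], D.IsTorsion →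
      {u : ℤ | (2 : ℤ) ∣ u - 1 ∧
        ¬ ∀ c ∈ unramifiedOutside κ.kerSubgroup (W.geomPrimaryTorsion 2) 2
            (↑S₀ : Set (HeightOneSpectrum (𝓞 ℚ))),
        (∀ v ∈ {v : HeightOneSpectrum (𝓞 ℚ) | ((2 : ℕ) : 𝓞 ℚ) ∈ v.asIdeal},
            u • W.conjH1 2 κ.kerSubgroup γ c - c ∈ W.localKerOver 2 κ.kerSubgroup (v.adicCompletion ℚ)) →
        (∀ w : InfinitePlace ℚ,
            u • W.conjH1 2 κ.kerSubgroup γ c - c ∈ W.localKerOver 2 κ.kerSubgroup w.Completion) →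
        ∃ (hu : (2 : ℤ) ∣ u - 1) (J : ℕ)
          (t : Π v : Place ℚ,
            galoisCohomology ((W.twistedTorsionGaloisModule 2 κ J u hu).toLocal v) 1),
          (∀ v : HeightOneSpectrum (𝓞 ℚ), ((2 : ℕ) : 𝓞 ℚ) ∉ v.asIdeal → t (Sum.inr v) = 0) ∧
          (∀ v ∈ {v : HeightOneSpectrum (𝓞 ℚ) | ((2 : ℕ) : 𝓞 ℚ) ∈ v.asIdeal},
            W.twistedTorsionToLocalH1 2 κ J u hu (v.adicCompletion ℚ) (t (Sum.inr v)) =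
              W.localResOver 2 κ.kerSubgroup (v.adicCompletion ℚ) c) ∧
          (∀ w : InfinitePlace ℚ,
            W.twistedTorsionToLocalH1 2 κ J u hu w.Completion (t (Sum.inl w)) =
              W.localResOver 2 κ.kerSubgroup w.Completion c) ∧
          (∀ [Finite (W.geomTorsion ((2 ^ J : ℕ) : ℤ))] (inv : LocalInvariants ℚ (2 ^ J)),
              inv.IsPerfect → inv.SumLocalTermEqZero → inv.UnramifiedOrthogonal → inv.SelmerComplement →
              inv.InjectiveAtRealPlaces →
            ∀ y ∈ (inv.dualSelmerStructure (W.twistedTorsionGaloisModule 2 κ J u hu)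
                (W.twistedKummerSelmerStructure 2 S₀ κ J u hu)).selmerGroup,
              (∀ v : HeightOneSpectrum (𝓞 ℚ), ((2 : ℕ) : 𝓞 ℚ) ∈ v.asIdeal →
                localTatePairingZMod (W.twistedTorsionGaloisModule 2 κ J u hu) (2 ^ J) (Sum.inr v)
                  (inv (Sum.inr v)) (t (Sum.inr v))
                  (galoisCohomology.localization
                    ((W.twistedTorsionGaloisModule 2 κ J u hu).tateDual (2 ^ J)) (Sum.inr v) 1 y) = 0) ∧
              (∀ w : InfinitePlace ℚ,
                localTatePairingZMod (W.twistedTorsionGaloisModule 2 κ J u hu) (2 ^ J) (Sum.inl w)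
                  (inv (Sum.inl w)) (t (Sum.inl w))
                  (galoisCohomology.localization
                    ((W.twistedTorsionGaloisModule 2 κ J u hu).tateDual (2 ^ J)) (Sum.inl w) 1 y) =
                  0))}.Finite) :
    ∀ (W : WeierstrassCurve ℚ) [W.IsElliptic] [W.IsGloballyMinimal],
      R W →
      ∀ (κ : ZpExtension ℚ 2) (_hκ : κ.IsCyclotomic) (γ : absoluteGaloisGroup ℚ)
        (_hγ : κ.IsTopGenerator γ) (S₀ : Finset (HeightOneSpectrum (𝓞 ℚ)))
        (_hne : S₀.Nonempty)
        (_hS₀ : ∀ v ∈ S₀, ((2 : ℕ) : 𝓞 ℚ) ∉ v.asIdeal)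
        (_hbad : ∀ v : HeightOneSpectrum (𝓞 ℚ), v ∉ S₀ → ((2 : ℕ) : 𝓞 ℚ) ∉ v.asIdeal →
          W.HasGoodReductionAt v)
        (D : W.SelmerDualData κ γ) [Module.Finite (IwasawaAlgebra 2) D.X], D.IsTorsion →
      {u : ℤ | (2 : ℤ) ∣ u - 1 ∧
        ¬ ∀ c ∈ unramifiedOutside κ.kerSubgroup (W.geomPrimaryTorsion 2) 2
            (↑S₀ : Set (HeightOneSpectrum (𝓞 ℚ))),
        (∀ v ∈ {v : HeightOneSpectrum (𝓞 ℚ) | ((2 : ℕ) : 𝓞 ℚ) ∈ v.asIdeal},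
            u • W.conjH1 2 κ.kerSubgroup γ c - c ∈ W.localKerOver 2 κ.kerSubgroup (v.adicCompletion ℚ)) →
        (∀ w : InfinitePlace ℚ,
            u • W.conjH1 2 κ.kerSubgroup γ c - c ∈ W.localKerOver 2 κ.kerSubgroup w.Completion) →
        ∃ (hu : (2 : ℤ) ∣ u - 1) (J : ℕ)
          (x : galoisCohomology (W.twistedTorsionGaloisModule 2 κ J u hu) 1),
          (∀ v : HeightOneSpectrum (𝓞 ℚ), v ∉ S₀ → ((2 : ℕ) : 𝓞 ℚ) ∉ v.asIdeal →
            galoisCohomology.res (W.twistedTorsionGaloisModule 2 κ J u hu) (v.adicCompletion ℚ) 1 x ∈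
              DiscreteGaloisModule.unramifiedSubgroup
                ((W.twistedTorsionGaloisModule 2 κ J u hu).restrictField (v.adicCompletion ℚ)) 1) ∧
          (∀ v ∈ {v : HeightOneSpectrum (𝓞 ℚ) | ((2 : ℕ) : 𝓞 ℚ) ∈ v.asIdeal},
            W.twistedTorsionToLocalH1 2 κ J u hu (v.adicCompletion ℚ)
                (galoisCohomology.res (W.twistedTorsionGaloisModule 2 κ J u hu) (v.adicCompletion ℚ) 1 x) =
              W.localResOver 2 κ.kerSubgroup (v.adicCompletion ℚ) c) ∧
          (∀ w : InfinitePlace ℚ,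
            W.twistedTorsionToLocalH1 2 κ J u hu w.Completion
                (galoisCohomology.res (W.twistedTorsionGaloisModule 2 κ J u hu) w.Completion 1 x) =
              W.localResOver 2 κ.kerSubgroup w.Completion c)}.Finite := by
  intro W _ _ hW κ hκ γ hγ S₀ hne hS₀ hbad D _ hD
  refine (LIFT₃ W hW κ hκ γ hγ S₀ hne hS₀ hbad D hD).subset fun u hu ↦ ⟨hu.1, fun hall ↦ hu.2 ?_⟩
  intro c hc h2 hinf
  obtain ⟨hu', J, t, ht0, ht2, htinf, horth⟩ := hall c hc h2 hinf
  haveI : NeZero (2 ^ J) := ⟨pow_ne_zero _ two_ne_zero⟩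
  haveI : Finite (W.geomTorsion ((2 ^ J : ℕ) : ℤ)) := finite_geomTorsion_of_neZero W (2 ^ J)
  obtain ⟨inv, hperf, hsum, hUO, hSC, hreal⟩ := hPT (2 ^ J)
  have hS : ∀ v : HeightOneSpectrum (𝓞 ℚ), (Sum.inr v : Place ℚ) ∉ twistedDescentPlaces (K := ℚ) 2 S₀ →
      ((2 ^ J : ℕ) : 𝓞 ℚ) ∉ v.asIdeal ∧
        GaloisRep.IsUnramifiedAt v (W.twistedTorsionGaloisModule 2 κ J u hu') := fun v hv ↦ by
    rw [not_mem_twistedDescentPlaces_iff] at hv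
    exact W.natCast_pow_not_mem_and_isUnramifiedAt_twistedTorsionGaloisModule 2 κ J u hu'
      (S₀ := (↑S₀ : Set (HeightOneSpectrum (𝓞 ℚ)))) (fun v hv' hpv ↦ hbad v (by exact_mod_cast hv') hpv)
      (by exact_mod_cast hv.1) hv.2
  obtain ⟨x, hxur, hx2, hxinf⟩ := W.exists_twistedLift_of_orthogonal_two 2 S₀ κ J u hu' hSC hS₀ hS t ht0
    (fun y hy ↦ horth inv hperf hsum hUO hSC hreal y hy)
  exact ⟨hu', J, x, hxur, fun v hv ↦ (hx2 v hv).trans (ht2 v hv), fun w ↦ (hxinf w).trans (htinf w)⟩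

/-- **`hF3b` from PRINT-by-name {Prop. 4.9, Poitou–Tate duality for Selmer structures} + the orthogonality
`LIFT₃`** (composition with file XXI `hF3b_of_prop49_level_R`). Record-only per RC-169 (no display is re-keyed).
[cite: GreenbergLNM1716, §4 Prop. 4.9, pp. 122–126] [cite: MilneADT2006, Ch. I, Thm. 4.10(b)] -/
theorem hF3b_of_prop49_PT_R (R : ∀ (W : WeierstrassCurve ℚ) [W.IsElliptic] [W.IsGloballyMinimal], Prop) (h49 : prop49_noFiniteSubmodule_H1Sigma)
    (hPT : poitouTate_selmerStructure_duality_real ℚ)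
    (LIFT₃ : ∀ (W : WeierstrassCurve ℚ) [W.IsElliptic] [W.IsGloballyMinimal],
      R W →
      ∀ (κ : ZpExtension ℚ 2) (_hκ : κ.IsCyclotomic) (γ : absoluteGaloisGroup ℚ)
        (_hγ : κ.IsTopGenerator γ) (S₀ : Finset (HeightOneSpectrum (𝓞 ℚ)))
        (_hne : S₀.Nonempty)
        (_hS₀ : ∀ v ∈ S₀, ((2 : ℕ) : 𝓞 ℚ) ∉ v.asIdeal)
        (_hbad : ∀ v : HeightOneSpectrum (𝓞 ℚ), v ∉ S₀ → ((2 : ℕ) : 𝓞 ℚ) ∉ v.asIdeal →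
          W.HasGoodReductionAt v)
        (D : W.SelmerDualData κ γ) [Module.Finite (IwasawaAlgebra 2) D.X], D.IsTorsion →
      {u : ℤ | (2 : ℤ) ∣ u - 1 ∧
        ¬ ∀ c ∈ unramifiedOutside κ.kerSubgroup (W.geomPrimaryTorsion 2) 2
            (↑S₀ : Set (HeightOneSpectrum (𝓞 ℚ))),
        (∀ v ∈ {v : HeightOneSpectrum (𝓞 ℚ) | ((2 : ℕ) : 𝓞 ℚ) ∈ v.asIdeal},
            u • W.conjH1 2 κ.kerSubgroup γ c - c ∈ W.localKerOver 2 κ.kerSubgroup (v.adicCompletion ℚ)) →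
        (∀ w : InfinitePlace ℚ,
            u • W.conjH1 2 κ.kerSubgroup γ c - c ∈ W.localKerOver 2 κ.kerSubgroup w.Completion) →
        ∃ (hu : (2 : ℤ) ∣ u - 1) (J : ℕ)
          (t : Π v : Place ℚ,
            galoisCohomology ((W.twistedTorsionGaloisModule 2 κ J u hu).toLocal v) 1),
          (∀ v : HeightOneSpectrum (𝓞 ℚ), ((2 : ℕ) : 𝓞 ℚ) ∉ v.asIdeal → t (Sum.inr v) = 0) ∧
          (∀ v ∈ {v : HeightOneSpectrum (𝓞 ℚ) | ((2 : ℕ) : 𝓞 ℚ) ∈ v.asIdeal},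
            W.twistedTorsionToLocalH1 2 κ J u hu (v.adicCompletion ℚ) (t (Sum.inr v)) =
              W.localResOver 2 κ.kerSubgroup (v.adicCompletion ℚ) c) ∧
          (∀ w : InfinitePlace ℚ,
            W.twistedTorsionToLocalH1 2 κ J u hu w.Completion (t (Sum.inl w)) =
              W.localResOver 2 κ.kerSubgroup w.Completion c) ∧
          (∀ [Finite (W.geomTorsion ((2 ^ J : ℕ) : ℤ))] (inv : LocalInvariants ℚ (2 ^ J)),
              inv.IsPerfect → inv.SumLocalTermEqZero → inv.UnramifiedOrthogonal → inv.SelmerComplement →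
              inv.InjectiveAtRealPlaces →
            ∀ y ∈ (inv.dualSelmerStructure (W.twistedTorsionGaloisModule 2 κ J u hu)
                (W.twistedKummerSelmerStructure 2 S₀ κ J u hu)).selmerGroup,
              (∀ v : HeightOneSpectrum (𝓞 ℚ), ((2 : ℕ) : 𝓞 ℚ) ∈ v.asIdeal →
                localTatePairingZMod (W.twistedTorsionGaloisModule 2 κ J u hu) (2 ^ J) (Sum.inr v)
                  (inv (Sum.inr v)) (t (Sum.inr v))
                  (galoisCohomology.localization
                    ((W.twistedTorsionGaloisModule 2 κ J u hu).tateDual (2 ^ J)) (Sum.inr v) 1 y) = 0) ∧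
              (∀ w : InfinitePlace ℚ,
                localTatePairingZMod (W.twistedTorsionGaloisModule 2 κ J u hu) (2 ^ J) (Sum.inl w)
                  (inv (Sum.inl w)) (t (Sum.inl w))
                  (galoisCohomology.localization
                    ((W.twistedTorsionGaloisModule 2 κ J u hu).tateDual (2 ^ J)) (Sum.inl w) 1 y) =
                  0))}.Finite) :
    ∀ (W : WeierstrassCurve ℚ) [W.IsElliptic] [W.IsGloballyMinimal],
      R W →
      ∀ (κ : ZpExtension ℚ 2) (_hκ : κ.IsCyclotomic) (γ : absoluteGaloisGroup ℚ)
        (_hγ : κ.IsTopGenerator γ) (S₀ : Finset (HeightOneSpectrum (𝓞 ℚ)))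
        (_hne : S₀.Nonempty)
        (_hS₀ : ∀ v ∈ S₀, ((2 : ℕ) : 𝓞 ℚ) ∉ v.asIdeal)
        (_hbad : ∀ v : HeightOneSpectrum (𝓞 ℚ), v ∉ S₀ → ((2 : ℕ) : 𝓞 ℚ) ∉ v.asIdeal →
          W.HasGoodReductionAt v)
        (D : W.SelmerDualData κ γ) [Module.Finite (IwasawaAlgebra 2) D.X], D.IsTorsion →
        ∀ (DS : NonPrimitiveDualData W κ γ (↑S₀ : Set (HeightOneSpectrum (𝓞 ℚ))))
          (N : Submodule (IwasawaAlgebra 2) DS.X), Finite N → N = ⊥ :=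
  (hF3b_of_prop49_level_R (R := R)) h49 ((levelLift_of_orthogonal_R (R := R)) hPT LIFT₃)

end Summit.BirchSwinnertonDyer.BirchSwinnertonDyer.Theorems.MultTransportTwistedDescent

end
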